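import Summits.ResolutionOfSingularities.ResolutionOfSingularities.Theorems.FrobeniusLadderFRationalResolutionContractedPrincipalDivisorial
import Summits.ResolutionOfSingularities.ResolutionOfSingularities.Theorems.FrobeniusLadderFRationalResolutionWeightGrading
import Literature.AlgebraicGeometry.Resolution.NodalFamilyRingDomain
import Mathlib.RingTheory.MvPowerSeries.Inverse
import Mathlib.RingTheory.MvPowerSeries.NoZeroDivisors
import HarnessLib

/-!
# Crux `FrobeniusLadder.FRationalResolution` (stmt-ResolutionOfSingularities-15317), line `redirect`,
# stub `stub_diagonalizableQuotientResolution` — THE NON-PRINCIPAL DIVISORIAL WITNESS `I₀` FOR WEIGHT-ZERO SUBRINGS OF `κ[[y]]`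
# (the `I₀` slot of the (S1) capstone p840173 for the whole isolated cyclic-quotient family at once)

`R ↪ A = κ[[y₁,…,yₙ]]` onto the weight-zero series for weights `w : Fin n → ℤ/r`. If a variable `y_{i₀}` has weight `w₀ ≠ 0` and another
variable `y_{i₁}` has powers of weights `w₀` and `−w₀` (automatic when `w(i₁)` generates `ℤ/r`, e.g. ALL isolated `1/r(1,a,b)`), then
`I₀ = y_{i₀}A ∩ R` is a NONZERO DIVISORIAL NON-PRINCIPAL ideal of `R`:

* `algebraMap_eq_of_weightZero` — `A ∩ Frac R = R` for the weight-zero subring (graded degree test, no normality needed);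
* `not_X_dvd_X_pow` — `y_{i₀} ∤ y_{i₁}^k` (`i₀ ≠ i₁`);
* ★★★ `exists_nonprincipal_divisorial_weightZero` — the witness (`…ContractedPrincipalDivisorial` with coprime partner `e = y_{i₁}^{k₁}`; if `I₀ = (x₀)`
  then `x₀/y_{i₀}` would divide both `y_{i₀}^{N−1}` and `y_{i₁}^{k₁'}` in the UFD `A` (`y_{i₀}` prime, tree `MvPowerSeries.prime_X'`), hence be a unit of
  weight `−w₀ ≠ 0` — impossible).

Honest label: algebra toward ONE leaf stub (no stub, crux or summit closed). No definitions, no named facts, no sorry. [folklore; cite: BrunsHerzog1993, §1.5]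
-/

noncomputable section

-- single-problem summit: the doubled namespace component is forced
set_option linter.dupNamespace false

open DirectSum SetLike
open Literature.AlgebraicGeometry.Resolution
open Summit.ResolutionOfSingularities.ResolutionOfSingularities.Theorems.FRationalResolution

namespace Summit.ResolutionOfSingularities.ResolutionOfSingularities.Theorems.FRationalResolution.WeightZeroNonPrincipal

/-- `y_{i₀} ∤ y_{i₁}^k` in `κ[[y]]` for `i₀ ≠ i₁`. [folklore] -/
theorem not_X_dvd_X_pow {n : ℕ} (κ : Type) [Field κ] {i₀ i₁ : Fin n} (hi : i₀ ≠ i₁) (k : ℕ) :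
    ¬ (MvPowerSeries.X i₀ : MvPowerSeries (Fin n) κ) ∣ MvPowerSeries.X i₁ ^ k := by
  classical
  intro h
  have hprime := MvPowerSeries.prime_X' κ i₀
  have h1 : (MvPowerSeries.X i₀ : MvPowerSeries (Fin n) κ) ∣ MvPowerSeries.X i₁ := by
    cases k with
    | zero =>
      rw [pow_zero] at h
      exact absurd (isUnit_of_dvd_one h) hprime.not_unit
    | succ k => exact hprime.dvd_of_dvd_pow h
  rw [MvPowerSeries.X_dvd_iff] at h1
  have h2 := h1 (Finsupp.single i₁ 1) (by rw [Finsupp.single_apply, if_neg (Ne.symm hi)])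
  rw [MvPowerSeries.coeff_X, if_pos rfl] at h2
  exact one_ne_zero h2

/-- ★★★ **The non-principal divisorial witness.** `R → κ[[y₁,…,yₙ]]` injective onto the weight-zero series (`w : Fin n → ℤ/r`, `r ≠ 0`), `i₀ ≠ i₁`,
`w i₀ ≠ 0`, and exponents `k₁, k₁'` with `k₁ • w i₁ = w i₀`, `k₁' • w i₁ + w i₀ = 0`: then `R` has a nonzero divisorial ideal which is not principal.
[folklore; cite: BrunsHerzog1993, §1.5] [cite: Matsumura1987, §11] -/
theorem exists_nonprincipal_divisorial_weightZero (κ : Type) [Field κ] (n r : ℕ) [NeZero r] (w : Fin n → ZMod r)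
    {R : Type} [CommRing R] [Algebra R (MvPowerSeries (Fin n) κ)]
    (hinj : Function.Injective (algebraMap R (MvPowerSeries (Fin n) κ)))
    (himage : ∀ f : MvPowerSeries (Fin n) κ,
      (∃ x : R, algebraMap R (MvPowerSeries (Fin n) κ) x = f) ↔ ∀ m : Fin n →₀ ℕ, MvPowerSeries.coeff m f ≠ 0 → Finsupp.weight w m = 0)
    {i₀ i₁ : Fin n} (hi : i₀ ≠ i₁) (hw₀ : w i₀ ≠ 0) {k₁ k₁' : ℕ} (hk₁ : k₁ • w i₁ = w i₀) (hk₁' : k₁' • w i₁ + w i₀ = 0) :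
    ∃ I : Ideal R, (I ≠ ⊥ ∧ ∀ x : R, (∀ c b : R, (∀ y ∈ I, b * y ∈ Ideal.span ({c} : Set R)) → b * x ∈ Ideal.span ({c} : Set R)) → x ∈ I) ∧
      ∀ x₀ ∈ I, I ≠ Ideal.span {x₀} := by
  classical
  obtain ⟨𝒜, inst, h𝒜⟩ := WeightGrading.exists_gradedAlgebra_weight κ w
  set A := MvPowerSeries (Fin n) κ with hA
  haveI : IsDomain A := NoZeroDivisors.to_isDomain _
  -- the image of `R` is `𝒜 0`
  have hR0 : ∀ x : R, algebraMap R A x ∈ 𝒜 0 := fun x => (h𝒜 0 _).mpr ((himage _).mp ⟨x, rfl⟩)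
  have hR0' : ∀ a : A, a ∈ 𝒜 0 → ∃ x : R, algebraMap R A x = a := fun a ha => (himage a).mpr ((h𝒜 0 a).mp ha)
  -- variables are homogeneous
  have hX : ∀ i : Fin n, (MvPowerSeries.X i : A) ∈ 𝒜 (w i) := by
    intro i
    rw [h𝒜]
    intro m hm
    rw [MvPowerSeries.coeff_X] at hm
    split_ifs at hm with h
    · rw [h, Finsupp.weight_apply, Finsupp.sum_single_index (by simp)]
      simp
    · exact (hm rfl).elim
  set d : A := MvPowerSeries.X i₀ with hd
  have hd0 : d ≠ 0 := (MvPowerSeries.prime_X' κ i₀).ne_zero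
  set N : ℕ := addOrderOf (w i₀) with hN
  have hNpos : 0 < N := addOrderOf_pos (w i₀)
  obtain ⟨N', hN'⟩ : ∃ N', N = N' + 1 := ⟨N - 1, by omega⟩
  -- `A ∩ Frac R = R`
  have hFrac : ∀ (x : A) (r₁ r₂ : R), r₂ ≠ 0 → algebraMap R A r₂ * x = algebraMap R A r₁ → ∃ r : R, algebraMap R A r = x := by
    intro x r₁ r₂ hr₂ hx
    have hr₂0 : algebraMap R A r₂ ≠ 0 := fun h => hr₂ (hinj (by rw [h, map_zero]))
    have h1 : algebraMap R A r₂ * x ∈ 𝒜 0 := hx ▸ hR0 r₁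
    have h2 := (GradedLocalPrincipal.mul_mem_grade_zero_iff 𝒜 (hR0 r₂) hr₂0 x).mp h1
    rw [neg_zero] at h2
    exact hR0' x h2
  -- `c₀ = d^N`, `b₀ = d^{N'} e`, `e = y_{i₁}^{k₁}`
  have hdegN : (N' + 1) • w i₀ = 0 := by
    rw [← hN', hN, addOrderOf_nsmul_eq_zero]
  have hdN : d ^ (N' + 1) ∈ 𝒜 0 := by
    have h := SetLike.pow_mem_graded (N' + 1) (hX i₀)
    rwa [hdegN] at h
  obtain ⟨c₀, hc₀⟩ := hR0' _ hdN
  have he : (MvPowerSeries.X i₁ : A) ^ k₁ ∈ 𝒜 (w i₀) := hk₁ ▸ SetLike.pow_mem_graded k₁ (hX i₁)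
  have hb : d ^ N' * MvPowerSeries.X i₁ ^ k₁ ∈ 𝒜 0 := by
    have h := SetLike.GradedMul.mul_mem (SetLike.pow_mem_graded N' (hX i₀)) he
    have hdeg : N' • w i₀ + w i₀ = 0 := by
      rw [← succ_nsmul]
      exact hdegN
    rwa [hdeg] at h
  obtain ⟨b₀, hb₀⟩ := hR0' _ hb
  have hcop : ∀ x : A, d ∣ MvPowerSeries.X i₁ ^ k₁ * x → d ∣ x := fun x hx =>
    ((MvPowerSeries.prime_X' κ i₀).dvd_or_dvd hx).resolve_left (not_X_dvd_X_pow κ hi k₁)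
  obtain ⟨hI0, hIdiv⟩ := ContractedPrincipalDivisorial.divisorial_comap_span_singleton hinj hFrac hd0 hc₀ hb₀ hcop
  refine ⟨(Ideal.span {d}).comap (algebraMap R A), ⟨hI0, hIdiv⟩, fun x₀ _ hI => ?_⟩
  -- a principal `I₀` gives a common divisor `s₀ ∈ 𝒜 (−w₀)` of `𝒜 (−w₀)`
  obtain ⟨s₀, hs₀, hdiv⟩ := ContractedPrincipalDivisorial.forall_dvd_of_grade_of_principal 𝒜 hR0 hR0' (hX i₀) hd0 hI
  -- test elements `y_{i₀}^{N'}` and `y_{i₁}^{k₁'}` of weight `−w₀`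
  have hnegw : N' • w i₀ = -w i₀ := by
    rw [eq_neg_iff_add_eq_zero, ← succ_nsmul]
    exact hdegN
  have ht₁ : d ^ N' ∈ 𝒜 (-w i₀) := hnegw ▸ SetLike.pow_mem_graded N' (hX i₀)
  have ht₂ : (MvPowerSeries.X i₁ : A) ^ k₁' ∈ 𝒜 (-w i₀) :=
    (eq_neg_iff_add_eq_zero.mpr hk₁') ▸ SetLike.pow_mem_graded k₁' (hX i₁)
  have h1 := hdiv _ ht₁
  have h2 := hdiv _ ht₂
  -- `s₀ ~ y_{i₀}^j`, and `j = 0`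
  obtain ⟨j, -, hj⟩ := (dvd_prime_pow (MvPowerSeries.prime_X' κ i₀) N').mp h1
  have hj0 : j = 0 := by
    by_contra hj0
    have h3 : d ∣ MvPowerSeries.X i₁ ^ k₁' :=
      (dvd_pow_self d hj0).trans (hj.symm.dvd.trans h2)
    exact not_X_dvd_X_pow κ hi k₁' h3
  rw [hj0, pow_zero] at hj
  -- so `s₀` is a unit, of weight `−w₀ ≠ 0`: contradiction
  have hunit : IsUnit s₀ := hj.symm.isUnit isUnit_one
  have hc : MvPowerSeries.coeff (0 : Fin n →₀ ℕ) s₀ ≠ 0 := by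
    rw [MvPowerSeries.coeff_zero_eq_constantCoeff_apply]
    exact (MvPowerSeries.isUnit_iff_constantCoeff.mp hunit).ne_zero
  have hw : Finsupp.weight w (0 : Fin n →₀ ℕ) = -w i₀ := (h𝒜 _ s₀).mp hs₀ 0 hc
  rw [map_zero] at hw
  exact hw₀ (neg_eq_zero.mp hw.symm)

end Summit.ResolutionOfSingularities.ResolutionOfSingularities.Theorems.FRationalResolution.WeightZeroNonPrincipal

end
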